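import Summits.CriticalPhenomena.CardyFormulaZ2.Theses.CardyWickAnisotropy
import Summits.CriticalPhenomena.CardyFormulaZ2.Theorems.CardyWickAnisotropySelfDuality
import Literature.Probability.RandomPlanarGeometry.KlebanZagierTheorem2
import Literature.Probability.RandomPlanarGeometry.CardyFunctionIncBeta
import Literature.Probability.Percolation.StarTriangleIsoradial
import HarnessLib

/-!
# Stub `stub_evenJets` of line `birth`, crux `CardyWickAnisotropy.AnisotropicBoxCardy`
(stmt-CriticalPhenomena-14309): the even jets at the self-dual square

For every holomorphic `G` on `D = ball (1/2) (1/2)` taking the Cardy values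
`G (criticalWeight (α/2)) = Π_h (cot (α/2))` on the critical segment and every EVEN `k`,
`iteratedDeriv k (V n) (1/2) → iteratedDeriv k G (1/2)`: for `k = 0` both sides are `1/2`
(`V n (1/2) = 1/2` by the landed `SelfDuality`; `G (1/2) = Π_h 1 = F (λ(i)) = F (1/2) = 1/2`), and for
even `k ≥ 2` both vanish (`V n p + V n (1-p) = 1` for all `p`; `G p + G (1-p) = 1` on `D` by the
identity theorem from the segment, where it is `Π_h (r) + Π_h (1/r) = F(λ) + F(1-λ) = 1`).
-/

namespace Summit.CriticalPhenomena.CardyFormulaZ2.Theorems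

open scoped Classical
open Filter Topology

/-! ### Jets at `1/2` of a function with `f p + f (1 - p) = 1` -/

/-- If `f (1/2) + f (1 - 1/2) = 1` then `f (1/2) = 1/2`. -/
private theorem apply_half_of_symm {f : ℂ → ℂ} (hf : f ((1:ℂ) / 2) + f (1 - (1:ℂ) / 2) = 1) :
    f ((1:ℂ) / 2) = 1 / 2 := by
  rw [show (1:ℂ) - 1 / 2 = 1 / 2 by norm_num] at hf
  linear_combination hf / 2

/-- If `f p + f (1 - p) = 1` near `p = 1/2` then every even iterated derivative of positive order
of `f` at `1/2` vanishes (`iteratedDeriv_comp_const_sub`: the `k`-th derivative of `p ↦ f (1 - p)`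
at `1/2` is `(-1)^k` times that of `f`). -/
private theorem iteratedDeriv_half_eq_zero_of_symm {f : ℂ → ℂ} {k : ℕ} (hk : Even k) (hk0 : 0 < k)
    (hf : ∀ᶠ p in 𝓝 ((1:ℂ) / 2), f p + f (1 - p) = 1) :
    iteratedDeriv k f ((1:ℂ) / 2) = 0 := by
  have h1 : f =ᶠ[𝓝 ((1:ℂ) / 2)] fun p ↦ (1:ℂ) - f (1 - p) :=
    hf.mono fun p hp ↦ by simp only; linear_combination hp
  have h2 := h1.iteratedDeriv_eq k
  rw [iteratedDeriv_const_sub hk0 (1:ℂ) (f := fun p ↦ f (1 - p)), iteratedDeriv_neg,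
    iteratedDeriv_comp_const_sub] at h2
  simp only [Even.neg_one_pow hk, one_smul, show (1:ℂ) - 1 / 2 = 1 / 2 by norm_num] at h2
  linear_combination h2 / 2

/-! ### The critical weights accumulate at `1/2` -/

/-- `criticalWeight (α/2) = 1/2` forces `α = π/2` on `(0, π)` (injectivity of `sin` on
`[-π/2, π/2]`). -/
private theorem eq_pi_div_two_of_criticalWeight_eq {α : ℝ} (hα : α ∈ Set.Ioo (0:ℝ) Real.pi)
    (h : Literature.Probability.LatticeModels.criticalWeight (α / 2) = 1 / 2) : α = Real.pi / 2 := by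
  unfold Literature.Probability.LatticeModels.criticalWeight at h
  obtain ⟨h0, hπ⟩ := hα
  have ha : 0 < Real.sin (2 * (α / 2) / 3) :=
    Real.sin_pos_of_pos_of_lt_pi (by linarith) (by linarith [Real.pi_pos])
  have hb : 0 < Real.sin ((Real.pi - 2 * (α / 2)) / 3) :=
    Real.sin_pos_of_pos_of_lt_pi (by linarith) (by linarith [Real.pi_pos])
  rw [div_eq_iff (add_pos ha hb).ne'] at h
  have hab : Real.sin (2 * (α / 2) / 3) = Real.sin ((Real.pi - 2 * (α / 2)) / 3) := by
    linear_combination 2 * h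
  have := Real.injOn_sin ⟨by linarith [Real.pi_pos], by linarith [Real.pi_pos]⟩
    ⟨by linarith [Real.pi_pos], by linarith [Real.pi_pos]⟩ hab
  linarith

/-- The points `criticalWeight (α/2)`, `α ∈ (0, π)`, accumulate at `1/2 = criticalWeight (π/4)`
inside the punctured plane: they form a continuous real curve through `1/2` (at `α = π/2`) that
avoids `1/2` for `α ≠ π/2`. -/
private theorem frequently_eq_criticalWeight :
    ∃ᶠ z in 𝓝[≠] ((1:ℂ) / 2), ∃ α ∈ Set.Ioo (0:ℝ) Real.pi,
      z = ((Literature.Probability.LatticeModels.criticalWeight (α / 2) : ℝ) : ℂ) := by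
  set c : ℝ → ℂ := fun α ↦
    ((Literature.Probability.LatticeModels.criticalWeight (α / 2) : ℝ) : ℂ) with hc
  have hcval : c (Real.pi / 2) = (1:ℂ) / 2 := by
    simp only [hc, show Real.pi / 2 / 2 = Real.pi / 4 by ring,
      Literature.Probability.LatticeModels.criticalWeight_pi_div_four]
    push_cast; ring
  have hden : Real.sin (2 * (Real.pi / 2 / 2) / 3) + Real.sin ((Real.pi - 2 * (Real.pi / 2 / 2)) / 3) ≠ 0 := by
    rw [show 2 * (Real.pi / 2 / 2) / 3 = Real.pi / 6 by ring,
      show (Real.pi - 2 * (Real.pi / 2 / 2)) / 3 = Real.pi / 6 by ring, Real.sin_pi_div_six]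
    norm_num
  have hcont : ContinuousAt c (Real.pi / 2) := by
    have hf : Continuous fun α : ℝ ↦ Real.sin (2 * (α / 2) / 3) := by fun_prop
    have hg : Continuous fun α : ℝ ↦
        Real.sin (2 * (α / 2) / 3) + Real.sin ((Real.pi - 2 * (α / 2)) / 3) := by fun_prop
    have hcw : ContinuousAt
        (fun α : ℝ ↦ Literature.Probability.LatticeModels.criticalWeight (α / 2)) (Real.pi / 2) :=
      hf.continuousAt.div hg.continuousAt hden
    exact Complex.continuous_ofReal.continuousAt.comp hcw
  have hIoo : ∀ᶠ α in 𝓝[≠] (Real.pi / 2), α ∈ Set.Ioo (0:ℝ) Real.pi :=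
    eventually_nhdsWithin_of_eventually_nhds
      (isOpen_Ioo.mem_nhds ⟨by positivity, by linarith [Real.pi_pos]⟩)
  have hne : ∀ᶠ α in 𝓝[≠] (Real.pi / 2), c α ∈ ({(1:ℂ) / 2}ᶜ : Set ℂ) := by
    filter_upwards [hIoo, self_mem_nhdsWithin] with α hα hα'
    intro hcα
    apply hα'
    apply eq_pi_div_two_of_criticalWeight_eq hα
    have h1 : c α = 1 / 2 := Set.mem_singleton_iff.1 hcα
    have h2 : ((Literature.Probability.LatticeModels.criticalWeight (α / 2) : ℝ) : ℂ) = 1 / 2 := h1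
    apply Complex.ofReal_injective
    rw [h2]; push_cast; ring
  have hten : Tendsto c (𝓝[≠] (Real.pi / 2)) (𝓝[≠] ((1:ℂ) / 2)) :=
    tendsto_nhdsWithin_of_tendsto_nhds_of_eventually_within c
      (hcval ▸ hcont.tendsto.mono_left nhdsWithin_le_nhds) hne
  exact hten.frequently (hIoo.mono fun α hα ↦ ⟨α, hα, rfl⟩).frequently

/-! ### The Cardy side is self-dual: `Π_h (r) + Π_h (1/r) = 1` -/

/-- `Π_h (t) + Π_h (t⁻¹) = 1` for `t > 0`: `((θ₂/θ₃)(it))⁴ = λ(it)`, `λ(i/t) = 1 - λ(it)`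
(`KlebanZagier.lamR_inv`) and `F (1 - η) = 1 - F (η)` (`cardyFunction_one_sub_holds`). -/
private theorem cardyPi_add_cardyPi_inv {t : ℝ} (ht : 0 < t) :
    Literature.Probability.RandomPlanarGeometry.cardyFunction
        (((Literature.NumberTheory.EllipticCurves.JacobiThetaNull.theta2 (Complex.I * (t : ℂ)) /
          Literature.NumberTheory.EllipticCurves.JacobiThetaNull.theta3 (Complex.I * (t : ℂ))) ^ 4).re) +
      Literature.Probability.RandomPlanarGeometry.cardyFunction
        (((Literature.NumberTheory.EllipticCurves.JacobiThetaNull.theta2 (Complex.I * ((t⁻¹ : ℝ) : ℂ)) /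
          Literature.NumberTheory.EllipticCurves.JacobiThetaNull.theta3
            (Complex.I * ((t⁻¹ : ℝ) : ℂ))) ^ 4).re) = 1 := by
  rw [div_pow, div_pow, ← Literature.Probability.RandomPlanarGeometry.KlebanZagier.lamC,
    ← Literature.Probability.RandomPlanarGeometry.KlebanZagier.lamC,
    Literature.Probability.RandomPlanarGeometry.KlebanZagier.lamC_I_mul ht,
    Literature.Probability.RandomPlanarGeometry.KlebanZagier.lamC_I_mul (inv_pos.2 ht),
    Complex.ofReal_re, Complex.ofReal_re,
    Literature.Probability.RandomPlanarGeometry.KlebanZagier.lamR_inv ht,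
    Literature.Probability.RandomPlanarGeometry.cardyFunction_one_sub_holds
      (Set.Ioo_subset_Icc_self
        (Literature.Probability.RandomPlanarGeometry.KlebanZagier.lamR_mem_Ioo ht))]
  ring

/-- On the critical segment the Cardy values are self-dual: if `G (criticalWeight (α/2)) =
Π_h (cot (α/2))` for all `α ∈ (0, π)`, then `G (p) + G (1 - p) = 1` at `p = criticalWeight (α/2)`
(`1 - criticalWeight (α/2) = criticalWeight ((π - α)/2)`, `cot ((π - α)/2) = (cot (α/2))⁻¹`). -/
private theorem cardySide_symm {G : ℂ → ℂ}
    (hval : ∀ α ∈ Set.Ioo (0:ℝ) Real.pi,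
      G ((Literature.Probability.LatticeModels.criticalWeight (α / 2) : ℝ) : ℂ) =
        ((Literature.Probability.RandomPlanarGeometry.cardyFunction
          (((Literature.NumberTheory.EllipticCurves.JacobiThetaNull.theta2
              (Complex.I * ((Real.cos (α / 2) / Real.sin (α / 2) : ℝ) : ℂ)) /
            Literature.NumberTheory.EllipticCurves.JacobiThetaNull.theta3
              (Complex.I * ((Real.cos (α / 2) / Real.sin (α / 2) : ℝ) : ℂ))) ^ 4).re) : ℝ) : ℂ))
    {α : ℝ} (hα : α ∈ Set.Ioo (0:ℝ) Real.pi) :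
    G ((Literature.Probability.LatticeModels.criticalWeight (α / 2) : ℝ) : ℂ) +
      G (1 - ((Literature.Probability.LatticeModels.criticalWeight (α / 2) : ℝ) : ℂ)) = 1 := by
  obtain ⟨h0, hπ⟩ := hα
  have hα' : Real.pi - α ∈ Set.Ioo (0:ℝ) Real.pi := ⟨by linarith, by linarith⟩
  have hcw : 1 - ((Literature.Probability.LatticeModels.criticalWeight (α / 2) : ℝ) : ℂ) =
      ((Literature.Probability.LatticeModels.criticalWeight ((Real.pi - α) / 2) : ℝ) : ℂ) := by
    rw [show (Real.pi - α) / 2 = Real.pi / 2 - α / 2 by ring,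
      Literature.Probability.Percolation.StarTriangle.criticalWeight_pi_div_two_sub
        ⟨by linarith, by linarith⟩]
    push_cast; ring
  have hcos : Real.cos ((Real.pi - α) / 2) = Real.sin (α / 2) := by
    rw [show (Real.pi - α) / 2 = Real.pi / 2 - α / 2 by ring, Real.cos_pi_div_two_sub]
  have hsin : Real.sin ((Real.pi - α) / 2) = Real.cos (α / 2) := by
    rw [show (Real.pi - α) / 2 = Real.pi / 2 - α / 2 by ring, Real.sin_pi_div_two_sub]
  have hs : 0 < Real.sin (α / 2) := Real.sin_pos_of_pos_of_lt_pi (by linarith) (by linarith)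
  have hc : 0 < Real.cos (α / 2) := Real.cos_pos_of_mem_Ioo ⟨by linarith, by linarith⟩
  have ht : 0 < Real.cos (α / 2) / Real.sin (α / 2) := div_pos hc hs
  rw [hcw, hval α ⟨h0, hπ⟩, hval (Real.pi - α) hα', hcos, hsin,
    show Real.sin (α / 2) / Real.cos (α / 2) = (Real.cos (α / 2) / Real.sin (α / 2))⁻¹ by
      rw [inv_div]]
  exact_mod_cast cardyPi_add_cardyPi_inv ht

/-- Identity theorem: a holomorphic `G` on `D = ball (1/2) (1/2)` with `G (p) + G (1 - p) = 1` at
the points `p = criticalWeight (α/2)`, `α ∈ (0, π)` (which accumulate at `1/2 ∈ D`), satisfies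
`G (p) + G (1 - p) = 1` near `1/2` (indeed on all of `D`, which is symmetric under `p ↦ 1 - p`). -/
private theorem eventually_symm_of_differentiableOn {G : ℂ → ℂ}
    (hG : DifferentiableOn ℂ G (Metric.ball ((1:ℂ) / 2) (1 / 2)))
    (hzero : ∀ α ∈ Set.Ioo (0:ℝ) Real.pi,
      G ((Literature.Probability.LatticeModels.criticalWeight (α / 2) : ℝ) : ℂ) +
        G (1 - ((Literature.Probability.LatticeModels.criticalWeight (α / 2) : ℝ) : ℂ)) = 1) :
    ∀ᶠ p in 𝓝 ((1:ℂ) / 2), G p + G (1 - p) = 1 := by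
  have hD0 : ((1:ℂ) / 2) ∈ Metric.ball ((1:ℂ) / 2) (1 / 2) := Metric.mem_ball_self (by norm_num)
  have hmaps : Set.MapsTo (fun z : ℂ ↦ 1 - z) (Metric.ball ((1:ℂ) / 2) (1 / 2))
      (Metric.ball ((1:ℂ) / 2) (1 / 2)) := by
    intro z hz
    rw [Metric.mem_ball, dist_eq_norm] at hz ⊢
    rw [show (1 - z) - (1:ℂ) / 2 = -(z - 1 / 2) by ring, norm_neg]
    exact hz
  have hH : AnalyticOnNhd ℂ (fun z ↦ G z + G (1 - z)) (Metric.ball ((1:ℂ) / 2) (1 / 2)) := by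
    apply DifferentiableOn.analyticOnNhd _ Metric.isOpen_ball
    exact hG.add (hG.comp ((differentiableOn_const _).sub differentiableOn_id) hmaps)
  have hEq : Set.EqOn (fun z ↦ G z + G (1 - z)) (fun _ ↦ (1:ℂ)) (Metric.ball ((1:ℂ) / 2) (1 / 2)) :=
    hH.eqOn_of_preconnected_of_frequently_eq analyticOnNhd_const (convex_ball _ _).isPreconnected
      hD0 (frequently_eq_criticalWeight.mono fun z ⟨α, hα, hz⟩ ↦ by rw [hz]; exact hzero α hα)
  filter_upwards [Metric.isOpen_ball.mem_nhds hD0] with z hz using hEq hz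

/-- **Stub `stub_evenJets`** (line `birth` of crux `AnisotropicBoxCardy`): even jets of the amplitudes
`V n` at `p = 1/2` converge to the even jets of any holomorphic continuation `G` of the Cardy side. -/
theorem stub_evenJets :
    let E : ℕ → Finset (Sym2 (Literature.Probability.LatticeModels.Site 2)) := fun n ↦ ((Literature.Probability.Percolation.rectangle (n + 1) n ×ˢ Literature.Probability.Percolation.rectangle (n + 1) n).filter (fun xy ↦ (Literature.Probability.LatticeModels.zdGraph 2).Adj xy.1 xy.2)).image (fun xy ↦ s(xy.1, xy.2)); let w : ℂ → Sym2 (Literature.Probability.LatticeModels.Site 2) → ℂ := fun p e ↦ if (∃ x y : Literature.Probability.LatticeModels.Site 2, e = s(x, y) ∧ x 1 = y 1) then p else 1 - p; let V : ℕ → ℂ → ℂ := fun n p ↦ ∑ ω ∈ (E n).powerset, (if ((ω : Set (Sym2 (Literature.Probability.LatticeModels.Site 2))) ∈ Literature.Probability.Percolation.lrCrossing (n + 1) n) then ∏ e ∈ E n, (if e ∈ ω then w p e else 1 - w p e) else 0); let PiH : ℝ → ℝ := fun r ↦ Literature.Probability.RandomPlanarGeometry.cardyFunction (((Literature.NumberTheory.EllipticCurves.JacobiThetaNull.theta2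 (Complex.I * (r : ℂ)) / Literature.NumberTheory.EllipticCurves.JacobiThetaNull.theta3 (Complex.I * (r : ℂ))) ^ 4).re); ∀ G : ℂ → ℂ, DifferentiableOn ℂ G (Metric.ball ((1:ℂ) / 2) (1 / 2)) → (∀ α ∈ Set.Ioo (0:ℝ) Real.pi, G ((Literature.Probability.LatticeModels.criticalWeight (α / 2) : ℝ) : ℂ) = ((PiH (Real.cos (α / 2) / Real.sin (α / 2)) : ℝ) : ℂ)) → ∀ k : ℕ, Even k → Filter.Tendsto (fun n : ℕ ↦ iteratedDeriv k (V n) ((1:ℂ) / 2)) Filter.atTop (nhds (iteratedDeriv k G ((1:ℂ) / 2))) := by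
  intro E w V PiH G hG hval k hk
  -- the landed self-duality `V n p + V n (1 - p) = 1` (same `let` prefix, definitionally)
  have hSD : ∀ n : ℕ, ∀ p : ℂ, V n p + V n (1 - p) = 1 := cardyWickAnisotropy_selfDuality_proof
  -- the Cardy side: `G p + G (1 - p) = 1` near `1/2`
  have hGsym : ∀ᶠ p in 𝓝 ((1:ℂ) / 2), G p + G (1 - p) = 1 :=
    eventually_symm_of_differentiableOn hG (fun α hα ↦ cardySide_symm hval hα)
  rcases Nat.eq_zero_or_pos k with rfl | hk0
  · -- `k = 0`: both sides are `1/2`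
    have hV : ∀ n, V n ((1:ℂ) / 2) = 1 / 2 := fun n ↦ apply_half_of_symm (hSD n _)
    have hG0 : G ((1:ℂ) / 2) = 1 / 2 := apply_half_of_symm hGsym.self_of_nhds
    simp only [iteratedDeriv_zero, hV, hG0]
    exact tendsto_const_nhds
  · -- even `k ≥ 2`: both sides vanish
    have hV : ∀ n, iteratedDeriv k (V n) ((1:ℂ) / 2) = 0 := fun n ↦
      iteratedDeriv_half_eq_zero_of_symm hk hk0 (Eventually.of_forall (hSD n))
    have hG0 : iteratedDeriv k G ((1:ℂ) / 2) = 0 := iteratedDeriv_half_eq_zero_of_symm hk hk0 hGsym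
    simp only [hV, hG0]
    exact tendsto_const_nhds

end Summit.CriticalPhenomena.CardyFormulaZ2.Theorems
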